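import Literature.Probability.RandomPlanarGeometry.HalfPlaneAutomorphism
import Literature.Probability.RandomPlanarGeometry.ConformalMapRiemannProofs
import Literature.Analysis.Complex.SimplyConnectedOfCompl
import Literature.Probability.RandomPlanarGeometry.ConformalMapCaratheodoryProofs
import Literature.Probability.RandomPlanarGeometry.CaratheodoryExtension
import HarnessLib

/-!
# Uniformizing maps of marked Jordan domains: `MarkedDomain.exists_isUniformizing` from Carathéodory

`Literature.Probability.RandomPlanarGeometry.ConformalRectangle` vendors as the named fact
`Literature.Probability.RandomPlanarGeometry.MarkedDomain.exists_isUniformizing` the existence, for every Jordan domain `D` with `n` marked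
boundary points `D.pt i` (met in this order along the boundary loop), of a conformal equivalence
`φ : ℍₒ → D` together with real points `x₀, …, x_{n-1}`, strictly monotone or strictly antitone,
such that `φ` has boundary value `D.pt i` at `x i` (Riemann mapping + Carathéodory; Ahlfors
(1979), Ch. 6 §1.1; Pommerenke (1992), Thm. 2.6 and Cor. 2.7; Werner (2007), §3).

This file **proves** it:

* `Literature.MarkedDomain.exists_isUniformizing_holds : MarkedDomain.exists_isUniformizing`.

It also discharges the companion named fact of the same file, the conformal invariance of Cardy's
cross-ratio (well-definedness of the conformal modulus of a conformal rectangle; Pommerenke (1992),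
Cor. 2.7 and §2.3, Exercise 2; Ahlfors (1979), Ch. 3 §3.2):

* `Literature.Probability.RandomPlanarGeometry.ConformalRectangle.crossRatio_eq_of_isUniformizing_holds :
    ConformalRectangle.crossRatio_eq_of_isUniformizing`

as the reduction `ConformalRectangle.crossRatio_eq_of_isUniformizing_of_disc` (`HalfPlaneAutomorphism`)
applied to `JordanDomain.exists_continuousOn_extension_holds`; and, in the same way, the uniqueness of
chordal uniformizing maps up to dilation (Lawler (2005), §6.1):

* `Literature.Probability.RandomPlanarGeometry.MarkedDomain.IsChordalUniformizing.exists_eq_trans_smul_holds :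
    MarkedDomain.IsChordalUniformizing.exists_eq_trans_smul`

as `IsChordalUniformizing.exists_eq_trans_smul_of_disc` applied to the same theorem.

The proof goes through Carathéodory's theorem in its printed disc form
`Literature.Probability.RandomPlanarGeometry.JordanDomain.exists_continuousOn_extension` (Pommerenke, *Boundary Behaviour of Conformal
Maps* (1992), Thm. 2.6: a conformal map of `𝔻` onto a Jordan domain extends continuously and
injectively to the closed disc, circle onto the boundary curve), now a theorem of the tree
(`Literature.Probability.RandomPlanarGeometry.JordanDomain.exists_continuousOn_extension_holds`, `ConformalMapCaratheodoryProofs.lean`,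
proved there without the Jordan curve theorem), the two other inputs being the Riemann mapping theorem
(`Literature.Probability.RandomPlanarGeometry.exists_conformalEquiv_ball_holds`, `ConformalMapRiemannProofs`) and simple connectivity of
Jordan domains (`Complex.isSimplyConnected_of_isPreconnected_frontier`,
`Literature.Analysis.Complex.SimplyConnectedOfCompl`: a bounded domain with connected frontier is
simply connected, Conway VIII.2.2; cf. `Literature.Probability.RandomPlanarGeometry.JordanDomain.isSimplyConnected_holds` in
`JordanDomainProofs`):

* `Literature.MarkedDomain.exists_isUniformizing_of_disc :
    JordanDomain.exists_continuousOn_extension → MarkedDomain.exists_isUniformizing`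
  (the reduction, Pommerenke's proof of Cor. 2.7 for `n` points);
* `Literature.MarkedDomain.exists_isUniformizing_of_jordanCurveTheorem :
    JordanCurveTheorem → MarkedDomain.exists_isUniformizing` (the same reduction composed with the
  older route `Literature.Probability.RandomPlanarGeometry.JordanDomain.exists_continuousOn_extension_of_jordanCurveTheorem` of
  `CaratheodoryExtension`, kept for reference).

Construction (Pommerenke (1992), proof of Cor. 2.7, for `n` instead of three points). Let
`ψ : D → 𝔻` be a Riemann map, `Ψ` the Carathéodory extension of `ψ⁻¹`, and `Φ = (Ψ|_{∂𝔻})⁻¹`,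
a continuous map `∂D → ∂𝔻` (continuous bijection of the compact circle,
`Literature.Probability.RandomPlanarGeometry.continuousOn_invFunOn_of_isCompact`). The marks `D.mark i ∈ [0, 1)` increase with `i`; pick a
parameter `t₁ ∈ (last mark, 1)`, the boundary point `p₁ = D.boundary t₁` (not a marked point) and
`η = Φ p₁`. Then `φ = ψ⁻¹ ∘ (η ·) ∘ cayley : ℍₒ → D` has boundary value `Ψ (η · cayleyFun x)`
at each real `x` (`Literature.Probability.RandomPlanarGeometry.JordanDomain.tendsto_nhdsWithin_of_extension`), in particular `∞ ↦ p₁`, and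
the real boundary correspondence `g t = Re cayleyInv (η⁻¹ Φ (D.boundary t))` satisfies
`Ψ (η · cayleyFun (g t)) = D.boundary t` and is continuous and injective on `[0, last mark]`
(where `D.boundary t ≠ p₁`), hence strictly monotone or antitone there
(`ContinuousOn.strictMonoOn_of_injOn_Icc'`); so `x i = g (D.mark i)` works.

## Mathlib

We USE `Function.invFunOn` / `Set.BijOn.invOn_invFunOn` / `Set.SurjOn.mapsTo_invFunOn`,
`ContinuousOn.strictMonoOn_of_injOn_Icc'` (a continuous injective function on a compact interval
is strictly monotone or antitone), `isCompact_sphere`, `Fin.le_last`.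

## References

* Ch. Pommerenke, *Boundary Behaviour of Conformal Maps*, Springer (1992), Thm. 2.6 and Cor. 2.7.
* L. V. Ahlfors, *Complex Analysis*, 3rd ed. (1979), Ch. 6 §1.1, Thm. 1 (Riemann mapping theorem).
* W. Werner, *Lectures on two-dimensional critical percolation*, IAS/Park City (2007), §3.
* J. McCleary, *A First Course in Topology: Continuity and Dimension*, AMS (2006), Ch. 9.
-/

noncomputable section

open Set Filter Topology Complex Metric
open UpperHalfPlane (upperHalfPlaneSet isOpen_upperHalfPlaneSet)

namespace Literature.Probability.RandomPlanarGeometry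

/-! ### Inverse of a continuous bijection on a compact set -/

/-- **The inverse of a continuous bijection of a compact set is continuous.** If `Ψ` is continuous
on the compact set `K` and maps it bijectively onto `L` (in a Hausdorff space), then the inverse
`Function.invFunOn Ψ K` is continuous on `L`. (Set version of Mathlib's
`Continuous.continuous_symm_of_equiv_compact_to_t2`, via `Literature.Probability.RandomPlanarGeometry.tendsto_of_injOn_of_tendsto_comp`.) [folklore] -/
theorem continuousOn_invFunOn_of_isCompact {X Y : Type*} [TopologicalSpace X] [TopologicalSpace Y]
    [T2Space Y] [Nonempty X] {Ψ : X → Y} {K : Set X} {L : Set Y} (hK : IsCompact K)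
    (hΨ : ContinuousOn Ψ K) (hbij : BijOn Ψ K L) : ContinuousOn (Function.invFunOn Ψ K) L := by
  have hinv : InvOn (Function.invFunOn Ψ K) Ψ K L := hbij.invOn_invFunOn
  have hmaps : MapsTo (Function.invFunOn Ψ K) L K := hbij.surjOn.mapsTo_invFunOn
  intro p hp
  have hg : ∀ᶠ a in 𝓝[L] p, Function.invFunOn Ψ K a ∈ K :=
    eventually_nhdsWithin_of_forall fun a ha ↦ hmaps ha
  refine tendsto_of_injOn_of_tendsto_comp hK hΨ hbij.injOn hg (hmaps hp) ?_
  have hev : (Ψ ∘ Function.invFunOn Ψ K) =ᶠ[𝓝[L] p] id :=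
    eventually_nhdsWithin_of_forall fun a ha ↦ hinv.2 ha
  rw [hinv.2 hp]
  exact (tendsto_id.mono_left nhdsWithin_le_nhds).congr' hev.symm

namespace MarkedDomain

variable {n : ℕ}

/-- All marks of a marked domain lie in a compact parameter interval `[0, S]` with `S < 1`
(take `S` = the last mark, or `0` if there are no marks). [folklore] -/
theorem exists_mark_le (D : MarkedDomain n) : ∃ S : ℝ, 0 ≤ S ∧ S < 1 ∧ ∀ i, D.mark i ≤ S := by
  cases n with
  | zero => exact ⟨0, le_rfl, one_pos, fun i ↦ i.elim0⟩
  | succ k =>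
    exact ⟨D.mark (Fin.last k), (D.mark_mem _).1, (D.mark_mem _).2,
      fun i ↦ D.strictMono_mark.monotone (Fin.le_last i)⟩

/-- **Existence of uniformizing maps from Carathéodory's theorem (disc form).** Given Pommerenke's
Thm. 2.6 as vendored in `JordanDomain.exists_continuousOn_extension` (a conformal map of the unit
disc onto a Jordan domain extends continuously to the closed disc, bijectively, circle onto the
boundary), every marked Jordan domain `D` admits a conformal equivalence `φ : ℍₒ → D` and strictly
monotone or strictly antitone real points `x i` at which `φ` has boundary value the marked points
`D.pt i` (`MarkedDomain.exists_isUniformizing`). The Riemann mapping theorem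
(`exists_conformalEquiv_ball_holds`) and simple connectivity of Jordan domains
(`Complex.isSimplyConnected_of_isPreconnected_frontier`: the frontier `range D.boundary` is
connected) are theorems of the Literature tree. Proof: Riemann map
`ψ : D → 𝔻`, Carathéodory extension `Ψ` of `ψ⁻¹` with continuous inverse `Φ` on `∂D`; a boundary
point `p₁` past the last mark is sent to `∞` by `φ = ψ⁻¹ ∘ (Φ p₁ ·) ∘ cayley`, and the real
boundary correspondence `t ↦ Re cayleyInv ((Φ p₁)⁻¹ Φ (D.boundary t))` is continuous and injective,
hence strictly monotone or antitone, on `[0, last mark]`. Pommerenke, *Boundary Behaviour of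
Conformal Maps* (1992), Thm. 2.6 and Cor. 2.7 (there for three points); Ahlfors (1979), Ch. 6
§1.1, Thm. 1. [cite: PommerenkeBBCM1992, Thm. 2.6 and Cor. 2.7] -/
theorem exists_isUniformizing_of_disc (hC : JordanDomain.exists_continuousOn_extension) :
    exists_isUniformizing (n := n) := by
  intro D
  -- Riemann map `ψ : D → 𝔻` and the Carathéodory extension `Ψ` of `ψ⁻¹ : 𝔻 → D`
  have hsc : IsSimplyConnected D.carrier :=
    Complex.isSimplyConnected_of_isPreconnected_frontier D.isOpen D.isConnected D.isBounded
      (D.range_boundary ▸ isPreconnected_range D.continuous_boundary)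
  obtain ⟨ψ⟩ := (exists_conformalEquiv_ball_holds (U := D.carrier)) D.isOpen hsc D.carrier_ne_univ
  obtain ⟨Ψ, hΨc, hΨeq, -, hsph⟩ := hC D.toJordanDomain ψ.symm
  -- the inverse boundary correspondence `Φ : ∂D → ∂𝔻`
  set Φ : ℂ → ℂ := Function.invFunOn Ψ (sphere 0 1) with hΦdef
  have hΦK : MapsTo Φ (frontier D.carrier) (sphere 0 1) := hsph.surjOn.mapsTo_invFunOn
  have hΨΦ : ∀ p ∈ frontier D.carrier, Ψ (Φ p) = p := fun p hp ↦ hsph.invOn_invFunOn.2 hp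
  have hΦc : ContinuousOn Φ (frontier D.carrier) :=
    continuousOn_invFunOn_of_isCompact (isCompact_sphere 0 1) (hΨc.mono sphere_subset_closedBall)
      hsph
  have hΦ1 : ∀ p ∈ frontier D.carrier, ‖Φ p‖ = 1 := fun p hp ↦
    mem_sphere_zero_iff_norm.1 (hΦK hp)
  -- a parameter `t₁` past all the marks and the boundary point `p₁` sent to `∞`
  obtain ⟨S, hS0, hS1, hmS⟩ := D.exists_mark_le
  set t₁ : ℝ := (S + 1) / 2 with ht₁
  have hSt : S < t₁ := by rw [ht₁]; linarith
  have ht1 : t₁ < 1 := by rw [ht₁]; linarith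
  have ht0 : 0 ≤ t₁ := hS0.trans hSt.le
  set p₁ : ℂ := D.boundary t₁ with hp₁
  have hp₁f : p₁ ∈ frontier D.carrier := D.boundary_mem_frontier t₁
  -- boundary points with parameter in `[0, S]` are not `p₁`
  have hne : ∀ t ∈ Icc (0 : ℝ) S, D.boundary t ≠ p₁ := by
    intro t ht h
    have hts : t = t₁ :=
      D.injOn_boundary ⟨ht.1, (ht.2.trans_lt hSt).trans ht1⟩ ⟨ht0, ht1⟩ h
    exact absurd (ht.2.trans_lt hSt) (by rw [hts]; exact lt_irrefl _)
  set η : ℂ := Φ p₁ with hη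
  have hη1 : ‖η‖ = 1 := hΦ1 p₁ hp₁f
  have hη0 : η ≠ 0 := norm_ne_zero_iff.1 (by rw [hη1]; exact one_ne_zero)
  -- the rotated inverse Riemann map `ψ₂ = ψ⁻¹ ∘ (η ·)` and its extension `Ψ₂ = Ψ ∘ (η ·)`
  set ψ₂ : ConformalEquiv (ball (0 : ℂ) 1) D.carrier := (rotBall η hη1).trans ψ.symm with hψ₂
  set Ψ₂ : ℂ → ℂ := fun w ↦ Ψ (η * w) with hΨ₂
  have hrot : MapsTo (fun w : ℂ ↦ η * w) (closedBall 0 1) (closedBall 0 1) := fun w hw ↦ by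
    rw [mem_closedBall_zero_iff] at hw ⊢
    rwa [norm_mul, hη1, one_mul]
  have hΨ₂c : ContinuousOn Ψ₂ (closedBall 0 1) :=
    hΨc.comp (continuous_const_mul η).continuousOn hrot
  have hΨ₂eq : EqOn Ψ₂ ψ₂ (ball 0 1) := fun w hw ↦ hΨeq ((rotBall η hη1).mapsTo hw)
  -- the uniformizing map `φ = ψ₂ ∘ cayley : ℍₒ → D`
  set φ : ConformalEquiv upperHalfPlaneSet D.carrier := cayley.trans ψ₂ with hφ
  have hΨ₂eq' : EqOn Ψ₂ (cayley.symm.trans φ) (ball 0 1) := fun w hw ↦ by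
    rw [hΨ₂eq hw]
    change ψ₂ w = ψ₂ (cayley (cayley.symm w))
    rw [cayley.apply_symm_apply hw]
  -- the rotated circle preimage `w t` of `D.boundary t` and its real Cayley preimage `g t`
  set w : ℝ → ℂ := fun t ↦ η⁻¹ * Φ (D.boundary t) with hw
  set g : ℝ → ℝ := fun t ↦ (cayleyInvFun (w t)).re with hg
  have hw1 : ∀ t, ‖w t‖ = 1 := fun t ↦ by
    rw [hw]
    simp only [norm_mul, norm_inv, hη1, hΦ1 _ (D.boundary_mem_frontier t), inv_one, one_mul]
  have hwne : ∀ t, D.boundary t ≠ p₁ → w t ≠ 1 := by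
    intro t ht h1
    apply ht
    have h2 : Φ (D.boundary t) = η := by
      have : η * w t = η := by rw [h1, mul_one]
      rwa [hw, ← mul_assoc, mul_inv_cancel₀ hη0, one_mul] at this
    rw [← hΨΦ _ (D.boundary_mem_frontier t), h2, hη, hΨΦ _ hp₁f]
  have hcg : ∀ t, D.boundary t ≠ p₁ → cayleyFun (g t) = w t := fun t ht ↦ by
    rw [hg, ← cayleyInvFun_eq_ofReal_re (hw1 t), cayleyFun_cayleyInvFun (hwne t ht)]
  have hΨ₂g : ∀ t, D.boundary t ≠ p₁ → Ψ₂ (cayleyFun (g t)) = D.boundary t := fun t ht ↦ by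
    rw [hcg t ht, hΨ₂]
    change Ψ (η * (η⁻¹ * Φ (D.boundary t))) = D.boundary t
    rw [← mul_assoc, mul_inv_cancel₀ hη0, one_mul, hΨΦ _ (D.boundary_mem_frontier t)]
  -- `g` is continuous and injective, hence strictly monotone or antitone, on `[0, S]`
  have hgc : ContinuousOn g (Icc 0 S) := by
    have h1 : ContinuousOn (fun t ↦ Φ (D.boundary t)) (Icc 0 S) :=
      hΦc.comp D.continuous_boundary.continuousOn fun t _ ↦ D.boundary_mem_frontier t
    have h2 : ContinuousOn w (Icc 0 S) := continuousOn_const.mul h1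
    have h3 : ContinuousOn (fun t ↦ cayleyInvFun (w t)) (Icc 0 S) :=
      differentiableOn_cayleyInvFun.continuousOn.comp h2 fun t ht ↦ hwne t (hne t ht)
    exact continuous_re.comp_continuousOn h3
  have hgi : InjOn g (Icc 0 S) := by
    intro s hs t ht hst
    have h1 : w s = w t := by rw [← hcg s (hne s hs), ← hcg t (hne t ht), hst]
    have h2 : Φ (D.boundary s) = Φ (D.boundary t) := mul_left_cancel₀ (inv_ne_zero hη0) h1
    have h3 : D.boundary s = D.boundary t := by
      rw [← hΨΦ _ (D.boundary_mem_frontier s), h2, hΨΦ _ (D.boundary_mem_frontier t)]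
    exact D.injOn_boundary ⟨hs.1, hs.2.trans_lt hS1⟩ ⟨ht.1, ht.2.trans_lt hS1⟩ h3
  have hgm : StrictMonoOn g (Icc 0 S) ∨ StrictAntiOn g (Icc 0 S) :=
    hgc.strictMonoOn_of_injOn_Icc' hS0 hgi
  -- the boundary preimages of the marked points
  have hmI : ∀ i, D.mark i ∈ Icc (0 : ℝ) S := fun i ↦ ⟨(D.mark_mem i).1, hmS i⟩
  refine ⟨φ, fun i ↦ g (D.mark i), ?_, fun i ↦ ?_⟩
  · exact hgm.imp (fun h a b hab ↦ h (hmI a) (hmI b) (D.strictMono_mark hab))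
      (fun h a b hab ↦ h (hmI a) (hmI b) (D.strictMono_mark hab))
  · -- boundary value `D.pt i = D.boundary (D.mark i)` at `g (D.mark i)`
    have h1 : Tendsto φ (𝓝[upperHalfPlaneSet] (g (D.mark i) : ℂ))
        (𝓝 (Ψ₂ (cayleyFun (g (D.mark i))))) :=
      JordanDomain.tendsto_nhdsWithin_of_extension φ hΨ₂c hΨ₂eq' (by simp)
    rw [hΨ₂g _ (hne _ (hmI i))] at h1
    exact h1

/-- **Existence of uniformizing maps from the Jordan curve theorem.** Composing
`exists_isUniformizing_of_disc` with Carathéodory's theorem as proved from the Jordan curve theorem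
(`JordanDomain.exists_continuousOn_extension_of_jordanCurveTheorem`), the named fact
`MarkedDomain.exists_isUniformizing` holds as soon as `Literature.Topology.PlaneTopology.JordanCurveTheorem` (McCleary (2006),
Ch. 9) does; this is its only remaining literature input. Pommerenke (1992), Thm. 2.6 and
Cor. 2.7; Ahlfors (1979), Ch. 6 §1.1, Thm. 1. [cite: PommerenkeBBCM1992, Thm. 2.6 and Cor. 2.7] -/
theorem exists_isUniformizing_of_jordanCurveTheorem (hJ : Literature.Topology.PlaneTopology.JordanCurveTheorem) :
    exists_isUniformizing (n := n) :=
  exists_isUniformizing_of_disc (JordanDomain.exists_continuousOn_extension_of_jordanCurveTheorem hJ)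

/-- **`MarkedDomain.exists_isUniformizing` holds**: every marked Jordan domain `D` (with `n`
marked boundary points met in order along the boundary loop) admits a conformal equivalence
`φ : ℍₒ → D` and real points `x₀, …, x_{n-1}`, strictly monotone or strictly antitone, such that
`φ` has boundary value the `i`-th marked point at `x i`. Riemann mapping theorem
(`exists_conformalEquiv_ball_holds`; Ahlfors (1979), Ch. 6 §1.1, Thm. 1) + Carathéodory's
theorem (`JordanDomain.exists_continuousOn_extension_holds`; Pommerenke (1992), Thm. 2.6) + the
boundary bookkeeping of `exists_isUniformizing_of_disc` (Pommerenke (1992), proof of Cor. 2.7).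
All inputs are proved in the tree; no Jordan curve theorem. [cite: PommerenkeBBCM1992, Thm. 2.6 and Cor. 2.7] -/
theorem exists_isUniformizing_holds : exists_isUniformizing (n := n) :=
  exists_isUniformizing_of_disc JordanDomain.exists_continuousOn_extension_holds

end MarkedDomain

/-! ### Conformal invariance of Cardy's cross-ratio (the conformal modulus is well defined) -/

namespace ConformalRectangle

/-- **`ConformalRectangle.crossRatio_eq_of_isUniformizing` holds** (conformal invariance of
Cardy's cross-ratio): any two uniformizing data `(φ, x)`, `(φ', x')` of the same conformal
rectangle `R` — conformal equivalences `φ, φ' : ℍₒ → R` having boundary value the marked point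
`R.pt i` at the real point `x i`, resp. `x' i`, for `i = 0, …, 3` — have the same cross-ratio,
`crossRatio x = crossRatio x'`; i.e. the conformal modulus of a Jordan domain with four marked
boundary points does not depend on the uniformizing map. Unconditional: the reduction
`crossRatio_eq_of_isUniformizing_of_disc` of `HalfPlaneAutomorphism` (`φ⁻¹ ∘ φ'` is a real Möbius
self-map of `ℍₒ` with boundary value `x i` at `x' i`, by the injectivity of Carathéodory's
boundary correspondence, and Möbius maps preserve the cross-ratio — Ahlfors (1979), Ch. 3 §3.2,
"the cross ratio is invariant under linear transformations") applied to Carathéodory's theorem in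
its printed disc form, which is a theorem of the tree
(`JordanDomain.exists_continuousOn_extension_holds`, `ConformalMapCaratheodoryProofs`; Pommerenke
(1992), Thm. 2.6: a conformal map of `𝔻` onto a Jordan domain has a continuous injective
extension to the closed disc). Printed forms of the statement: Pommerenke (1992), Cor. 2.7 (a
conformal map between Jordan domains is determined by three boundary points) and §2.3,
Exercise 2 (for a Jordan domain with four cyclically ordered boundary points the modulus `q` of
the conformally equivalent rectangle `(0, q) × (0, 1)` is unique). [cite: PommerenkeBBCM1992, Thm. 2.6, Cor. 2.7 and §2.3 Exercise 2] -/
theorem crossRatio_eq_of_isUniformizing_holds : crossRatio_eq_of_isUniformizing :=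
  crossRatio_eq_of_isUniformizing_of_disc JordanDomain.exists_continuousOn_extension_holds

end ConformalRectangle

namespace MarkedDomain

/-- **`MarkedDomain.IsChordalUniformizing.exists_eq_trans_smul` holds** (uniqueness of chordal
uniformizing maps up to dilation): two chordal uniformizing maps `φ, φ'` of the same Dobrushin
domain `(D; a, b)` — conformal equivalences `ℍₒ → D` with boundary value `a` at `0` and `b` at
`∞` — satisfy `φ' = φ ∘ (c • ·)` on `ℍₒ` for some `c > 0` (Lawler (2005), §6.1, paragraph after
Remark 6.7: "any other such `F̂` can be written as `r F` for some `r > 0`"; the dilations are the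
only Möbius self-maps of `ℍₒ` fixing `0` and `∞`). Unconditional: the reduction
`IsChordalUniformizing.exists_eq_trans_smul_of_disc` of `HalfPlaneAutomorphism` (Schwarz's lemma
for the automorphism `φ⁻¹ ∘ φ'` of `ℍₒ`, which tends to `0` at `0` and to `∞` at `∞`) applied to
Carathéodory's theorem in its printed disc form, a theorem of the tree
(`JordanDomain.exists_continuousOn_extension_holds`, `ConformalMapCaratheodoryProofs`; Pommerenke
(1992), Thm. 2.6). [cite: Lawler2005, §6.1] -/
theorem IsChordalUniformizing.exists_eq_trans_smul_holds :
    IsChordalUniformizing.exists_eq_trans_smul :=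
  IsChordalUniformizing.exists_eq_trans_smul_of_disc JordanDomain.exists_continuousOn_extension_holds

end MarkedDomain

end Literature.Probability.RandomPlanarGeometry

end
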